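import Literature.Computability.Complexity.CodeFPFinite
import Summits.PneNP.PneNP.Theorems.SignDegCertBridge
import Summits.PneNP.PneNP.Theorems.LtfLocalAvoidFPMachine

/-!
# K1'' machine side (E1b / S3), brick M0: the canonical degree-2 certificate rows as a TABLE FUNCTION

Cell pnp-ideate, ROUND-18 item K1'' (`SignDeg2Signing.SignDeg2SigningFP k`): the engine statement is phrased with
the CANONICAL certificate `SignDeg2Signing.canonCert I h` (`= SignDegCertBridge.certOfIntCert` of the chosen uniform
integer certificates `certOf k 2 (I.table j) (h j)`), whose rows a polynomial-time machine cannot compute from the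
PROOF `h` — but can read off a FINITE TABLE indexed by the `2ᵏ`-bit truth table.  This file is that dictionary
(the `SignDegCertBridge.rowTable` / `greedyAvoid_c0` trick of rung F-N2a, one degree up):

* `rowTable₂ k P = (c0, c1, c2)` — the canonical rows of a table `P` of sign-degree `≤ 2` (zeros otherwise), and
  `canonCert_c0 / _c1 / _c2`: the rows of `canonCert I h` at output `j` ARE `rowTable₂ k (I.table j)` (by `dif_pos`;
  stated against `canonCert`'s definiens `certOfIntCert I le_rfl (fun j => certOf k 2 (I.table j) (h j))` so that
  this file imports no `Theses` module — `SignDeg2Signing.canonCert I h` is that term by `rfl`);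
* `certRow₂ k tab` — the same read off a TABLE BLOCK of a code (list form: `(c0, [c1 i]_i, [[c2 i i']_{i'}]_i)`,
  junk blocks ↦ zeros), `certRow₂_tabOf`, and `codeFP_certRow₂` (a finite lookup, hence polynomial time).

The leg list / block splitting / spots / trace / greedy stages of the sd-2 machine (re-indexing the landed CAND
machine `SfmBlMachine*` from «leg 3j+t» to an explicit list of `≤ 2·uniformW k 2` legs per output) build on this.
Restricted-model algorithmic infrastructure; nothing here bears on `P` versus `NP`.
-/

set_option linter.dupNamespace false -- `Summit.PneNP.PneNP.…`: summit = sub-problem name (D-0017 single-conjunct layout)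

namespace Summit.PneNP.PneNP.Theorems.Sd2BlMachine

open Literature.Computability.Complexity
open Summit.PneNP.PneNP.Theorems.SignDegCertBridge (certOf certOfIntCert)
open Summit.PneNP.PneNP.Theorems.LtfLocalAvoidFP (allBits mem_allBits tableOfBits tableOfBits_tabOf)
open Summit.PneNP.PneNP.Theorems.LocalMapDecodeFP (tabOf length_tabOf)

variable {k n m : ℕ}

/-! ## The row table -/

open Classical in
/-- The CANONICAL DEGREE-2 ROWS of a `k`-bit table: `(2·cz ∅, i ↦ 2·cz {i}, (i,i') ↦ [i ≠ i']·cz {i,i'})` of the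
chosen uniform integer certificate `certOf k 2 P h` when `P` has sign-degree `≤ 2`, zeros otherwise.  For fixed
`k` a finite constant table (`2^(2^k)` entries). -/
noncomputable def rowTable₂ (k : ℕ) (P : (Fin k → Bool) → Bool) : ℤ × (Fin k → ℤ) × (Fin k → Fin k → ℤ) :=
  if h : SignDegLE 2 P then
    (2 * (certOf k 2 P h).cz ∅, fun i => 2 * (certOf k 2 P h).cz {i},
      fun i i' => if i = i' then 0 else (certOf k 2 P h).cz {i, i'})
  else (0, 0, 0)

/-- The bias row of the canonical certificate is the table's. -/
theorem canonCert_c0 (I : LocalMap k n m) (h : ∀ j, SignDegLE 2 (I.table j)) (j : Fin m) :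
    (certOfIntCert I le_rfl fun j => certOf k 2 (I.table j) (h j)).c0 j = (rowTable₂ k (I.table j)).1 := by
  unfold rowTable₂; rw [dif_pos (h j)]; rfl

/-- The linear rows of the canonical certificate are the table's. -/
theorem canonCert_c1 (I : LocalMap k n m) (h : ∀ j, SignDegLE 2 (I.table j)) (j : Fin m) (i : Fin k) :
    (certOfIntCert I le_rfl fun j => certOf k 2 (I.table j) (h j)).c1 j i = (rowTable₂ k (I.table j)).2.1 i := by
  unfold rowTable₂; rw [dif_pos (h j)]; rfl

/-- The pair rows of the canonical certificate are the table's. -/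
theorem canonCert_c2 (I : LocalMap k n m) (h : ∀ j, SignDegLE 2 (I.table j)) (j : Fin m) (i i' : Fin k) :
    (certOfIntCert I le_rfl fun j => certOf k 2 (I.table j) (h j)).c2 j i i' = (rowTable₂ k (I.table j)).2.2 i i' := by
  unfold rowTable₂; rw [dif_pos (h j)]; rfl

/-- The canonical certificate has margin `2` (restated next to the rows for the machine's target `< 2m`). -/
theorem canonCert_τ_eq_two (I : LocalMap k n m) (h : ∀ j, SignDegLE 2 (I.table j)) : (certOfIntCert I le_rfl fun j => certOf k 2 (I.table j) (h j)).τ = 2 := rfl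

/-! ## The rows read off a table block -/

/-- The canonical rows READ OFF A TABLE BLOCK, in list form `(c0, [c1 i]_{i<k}, [[c2 i i']_{i'<k}]_{i<k})`
(junk blocks of the wrong length ↦ zeros; a FINITE lookup for the typing). -/
noncomputable def certRow₂ (k : ℕ) (tab : List Bool) : ℤ × List ℤ × List (List ℤ) :=
  if tab ∈ allBits (2 ^ k) then
    ((rowTable₂ k (tableOfBits k tab)).1, List.ofFn fun i => (rowTable₂ k (tableOfBits k tab)).2.1 i,
      List.ofFn fun i => List.ofFn fun i' => (rowTable₂ k (tableOfBits k tab)).2.2 i i')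
  else (0, [], [])

/-- On the table block of output `j` the lookup returns the canonical rows of its table. -/
theorem certRow₂_tabOf (I : LocalMap k n m) (j : Fin m) :
    certRow₂ k (tabOf I j) = ((rowTable₂ k (I.table j)).1, List.ofFn fun i => (rowTable₂ k (I.table j)).2.1 i,
      List.ofFn fun i => List.ofFn fun i' => (rowTable₂ k (I.table j)).2.2 i i') := by
  unfold certRow₂
  rw [if_pos (mem_allBits.2 (length_tabOf I j)), tableOfBits_tabOf]

/-- Entry `i` of the linear row list is `(certOfIntCert I le_rfl fun j => certOf k 2 (I.table j) (h j)).c1 j i`. -/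
theorem certRow₂_c1 (I : LocalMap k n m) (h : ∀ j, SignDegLE 2 (I.table j)) (j : Fin m) (i : Fin k) :
    (certRow₂ k (tabOf I j)).2.1.getD i.val 0 = (certOfIntCert I le_rfl fun j => certOf k 2 (I.table j) (h j)).c1 j i := by
  rw [certRow₂_tabOf, canonCert_c1 I h j i]
  simp [List.getD_eq_getElem?_getD, i.isLt]

/-- Entry `(i, i')` of the pair row lists is `(certOfIntCert I le_rfl fun j => certOf k 2 (I.table j) (h j)).c2 j i i'`. -/
theorem certRow₂_c2 (I : LocalMap k n m) (h : ∀ j, SignDegLE 2 (I.table j)) (j : Fin m) (i i' : Fin k) :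
    ((certRow₂ k (tabOf I j)).2.2.getD i.val []).getD i'.val 0 = (certOfIntCert I le_rfl fun j => certOf k 2 (I.table j) (h j)).c2 j i i' := by
  rw [certRow₂_tabOf, canonCert_c2 I h j i i']
  simp [List.getD_eq_getElem?_getD, i.isLt, i'.isLt]

/-- The bias entry is `(certOfIntCert I le_rfl fun j => certOf k 2 (I.table j) (h j)).c0 j`. -/
theorem certRow₂_c0 (I : LocalMap k n m) (h : ∀ j, SignDegLE 2 (I.table j)) (j : Fin m) :
    (certRow₂ k (tabOf I j)).1 = (certOfIntCert I le_rfl fun j => certOf k 2 (I.table j) (h j)).c0 j := by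
  rw [certRow₂_tabOf, canonCert_c0 I h j]

/-! ## Typing -/

section PolyTime

open CodeFP

/-- Code of a row record `(c0, [c1], [[c2]])`. -/
abbrev r2E : ℤ × List ℤ × List (List ℤ) → List Bool := pairE intE (pairE (rawE intE) (rawE (rawE intE)))

/-- **The degree-2 row lookup is polynomial time** (a finite chain of equality tests). -/
theorem codeFP_certRow₂ (k : ℕ) : CodeFP strE r2E (certRow₂ k) := by
  have he : Function.Injective strE := fun _ _ h => h
  exact (ofList (eα := strE) he r2E
    (fun tab => ((rowTable₂ k (tableOfBits k tab)).1, List.ofFn fun i => (rowTable₂ k (tableOfBits k tab)).2.1 i,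
      List.ofFn fun i => List.ofFn fun i' => (rowTable₂ k (tableOfBits k tab)).2.2 i i'))
    ((0 : ℤ), ([] : List ℤ), ([] : List (List ℤ))) (allBits (2 ^ k))).congr fun tab => by
      unfold certRow₂; split_ifs <;> rfl

end PolyTime

end Summit.PneNP.PneNP.Theorems.Sd2BlMachine
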